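import Summits.Parity.GeneralizedHardyLittlewood.Theorems.TwinLowerDensityToGHLUniformUpperBoundCount
import Summits.Parity.GeneralizedHardyLittlewood.Theorems.LeeYangFibresPrimeCellsRelativeGoldbach
import HarnessLib

/-!
# Goldbach representations: the uniform upper bound `R(N) ≤ C 𝔖(N) N/log² N + ε N/log² N`
(crux `TwinLowerDensityToGHL`, stmt-Parity-18380; corollary of `uniformUpperCount`)

The Goldbach face of the uniform counting rung `uniformUpperCount`
(`Theorems/TwinLowerDensityToGHLUniformUpperBoundCount.lean`): the systems `(n, N − n)` VARY with `N` but have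
`‖·‖_N ≤ 3`, so ONE threshold of the rung serves every `N` — exactly the shift-uniformity that the registered stub
`stub_shiftLift` (13151 → 0819) asks for two-sidedly.  With the tree's Goldbach dictionary
(`Cruxes.PrimeCellsRelative.Sketch`: `goldbachCount_eq_primePointCount`, `archFactor_goldbachSystem`,
`singularProduct_goldbachSystem`, `localFactor_goldbachSystem`): there is `C > 0` with

  `R(N) = #{(p, q) prime : p + q = N} ≤ C · 𝔖(N) · N / log² N + ε N / log² N`   for all `N ≥ N₀(ε)`,

`𝔖(N) = goldbachSingularSeries N` (`0` for odd `N`).  Upper half only (the classical sieve bound for Goldbach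
representations, Halberstam–Richert Thm. 3.11); the asymptotic is Hardy–Littlewood's Conjecture A =
`HardyLittlewoodGoldbach`, implied by stmt-Parity-0819 (tree `dimOne_implies_hardyLittlewoodGoldbach`).

References: H. Halberstam, H.-E. Richert, *Sieve Methods* (1974), Thm. 3.11 [HalberstamRichert1974];
G. H. Hardy, J. E. Littlewood, Acta Math. 44 (1923), Conjecture A [HardyLittlewood1923];
B. Green, T. Tao, Ann. of Math. 171 (2010), Example 2 [GreenTao2010].
-/

noncomputable section

open Finset Filter

namespace Summit.Parity.GeneralizedHardyLittlewood.TwinLowerDensityToGHLUniformUpperBound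

open Literature.NumberTheory.Sieve
open Summit.Parity.GeneralizedHardyLittlewood.Theorems.PairsToGHL.Negative
open Summit.Parity.GeneralizedHardyLittlewood.Cruxes.PrimeCellsRelative.Sketch

/-- **Uniform sieve upper bound for Goldbach representations**: there is `C > 0` such that for every
`ε > 0` and all large `N`, `R(N) ≤ C · 𝔖(N) · N / log² N + ε N / log² N` (`R = SingularSeries.goldbachCount`,
`𝔖 = goldbachSingularSeries`; for odd `N`, `𝔖(N) = 0`). [cite: HalberstamRichert1974, Thm. 3.11]
[cite: GreenTao2010, Example 2] -/
theorem goldbachCount_uniformUpper :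
    ∃ C : ℝ, 0 < C ∧ ∀ ε : ℝ, 0 < ε → ∃ N₀ : ℕ, ∀ N : ℕ, N₀ ≤ N →
      (SingularSeries.goldbachCount N : ℝ) ≤
        C * (goldbachSingularSeries N * N) / Real.log N ^ 2 + ε * N / Real.log N ^ 2 := by
  obtain ⟨C, hC, hmain⟩ := uniformUpperCount 2 3 (by norm_num)
  refine ⟨C, hC, fun ε hε => ?_⟩
  obtain ⟨N₀, hN₀⟩ := hmain ε hε
  refine ⟨max N₀ 1, fun N hN => ?_⟩
  have hN1 : 1 ≤ N := le_of_max_le_right hN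
  have h0 : N ≠ 0 := by omega
  have hnd : IsNondegenerateSystem (goldbachSystem (N : ℤ)) :=
    isNondegenerateSystem_goldbachSystem (by exact_mod_cast h0)
  have hK : Convex ℝ (Set.Icc (fun _ : Fin 1 => (0 : ℝ)) (fun _ => (N : ℝ))) := convex_Icc _ _
  have hKN : Set.Icc (fun _ : Fin 1 => (0 : ℝ)) (fun _ => (N : ℝ)) ⊆ realBox 1 N := by
    intro x hx
    simp only [realBox, Set.mem_Icc, Pi.le_def] at hx ⊢
    have hN0 : (0 : ℝ) ≤ N := Nat.cast_nonneg N
    exact ⟨fun i => by linarith [hx.1 i], fun i => hx.2 i⟩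
  have key := hN₀ N (le_of_max_le_left hN) (goldbachSystem (N : ℤ)) hnd
    (affLinSize_goldbachSystem_le hN1) _ hK hKN
  have hSP : singularProduct (goldbachSystem (N : ℤ)) = goldbachSingularSeries N := by
    rcases Nat.even_or_odd N with he | ho
    · exact singularProduct_goldbachSystem he h0
    · have h2 : ¬ 2 ∣ N := fun hd => (Nat.not_even_iff_odd.mpr ho) (even_iff_two_dvd.mpr hd)
      have hβ : localFactor (goldbachSystem (N : ℤ)) 2 = 0 := by
        rw [localFactor_goldbachSystem Nat.prime_two, localFactor_shiftPairSystem_of_not_dvd Nat.prime_two h2]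
        norm_num
      rw [singularProduct_eq_zero_of_localFactor_eq_zero _ hnd Nat.prime_two hβ]
      unfold goldbachSingularSeries
      rw [if_pos ho]
  rw [← goldbachCount_eq_primePointCount, archFactor_goldbachSystem, hSP, mul_comm (N : ℝ)] at key
  exact key

end Summit.Parity.GeneralizedHardyLittlewood.TwinLowerDensityToGHLUniformUpperBound

end
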